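import Summits.AtomisticToContinuum.Crystallization.Theorems.OverbindingBudgetAffineRunCutLevelsA
import Summits.AtomisticToContinuum.Crystallization.Theorems.OverbindingBudgetAffineRunCutLetter

/-!
# `OverbindingBudget` / crux `RobustDefectLimitWindows` (stmt-AtomisticToContinuum-31280) — «RunCut»: LEVELS OF THE PIVOT DATUM (assembly: `(T2-metric)+(β)`)

Support file (lens-4 g88, part 17; memo `g87/memo/SW-CHI.md` §10.8 (3); chart steps in `…RunCutLevelsA`).  In the re-based layer-rigidity datum at a
base site `i` (`…RunCutRebase.layer_rigidity_rebase_charts`, clauses as hypotheses over an abstract base frame `B` with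
`399/400·ν·‖z‖ ≤ ‖B z‖ ≤ 401/400·ν·‖z‖`, ν = `nearestDist y i`):

* §1 (β) ★★ `estab_of_near_label` — LEVEL IDENTIFICATION: a site within `2ν` of `y i` that sits within the clause tolerance `T = 0.390ν` of `B (mv a)`
  for SOME integer label `a` of coordinate sum `6ℓ₀`, `|ℓ₀| ≤ 2`, is ESTABLISHED at level `ℓ₀` with class `Cz ℓ₀`: the position clause gives it a layer
  label `ref ℓ′ + x`, the two labels differ by a model vector of norm `≤ 2T/(399/400·ν) < 0.79 < √(2/3)` = the LAYER SPACING
  (`…LevelsA.norm_mv_sq_ge_of_thsum`), so `ℓ′ = ℓ₀`; the establishment clause at level `ℓ₀` (box `|u| ≤ 16 ⊇ tsq ≤ 103`) and site uniqueness then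
  establish the site itself.  No in-plane identification of the label is claimed (nor needed).
* §2 `level_two_site_pos/neg` (levels `±2` = `…LevelsA.step_site` + §1), ★★ `level_site` (every level `ℓ ∈ {−2,…,2}` carries an established site
  within `2ν`), ★★★ `levels_fcc_of_not_hNear` — under `¬HNear 2 (3/50) (1/450) y i` (the `rh = 2` exclusion of the leaf `StackSwapGainFlatWide`) every
  class `Cz ℓ`, `|ℓ| ≤ 2`, is cubic (`fccL ∨ fccNegL`), by `…RunCutLetter.estab_class_fcc_of_not_hNear`.  This is the input «five consecutive cubic
  levels» of the letter-constancy / axis step (T3, `…RunCutSheetLetter`), produced from the pivot's OWN datum with no `HNear` site nearby.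
-/

namespace Summit.AtomisticToContinuum.Crystallization.Theorems.OverbindingBudgetAffineRunCutLevels

open Literature.Geometry.DiscreteGeometry (nearestDist nearestDist_nonneg fccTwoShellPattern hcpTwoShellPattern)
open Summit.AtomisticToContinuum.Crystallization.Theorems.OverbindingBudgetAffineCompressedCutKernel (T3 tsub tadd tsq thsum fccL fccNegL hcpL hcpAltL)
open Summit.AtomisticToContinuum.Crystallization.Theorems.OverbindingBudgetAffineCompressedCutCharts (mv mv_tadd mv_tsub norm_mv_sq Carries)
open Summit.AtomisticToContinuum.Crystallization.Theorems.OverbindingBudgetAffineCompressedCutEstablish (Estab)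
open Summit.AtomisticToContinuum.Crystallization.Theorems.OverbindingBudgetAffineCompressedCutSeed (InLayer)
open Summit.AtomisticToContinuum.Crystallization.Theorems.OverbindingBudgetAffineCompressedCutPatch (capv dL thsum_capv)
open Summit.AtomisticToContinuum.Crystallization.Theorems.OverbindingBudgetAffineCompressedCutBudget (tauR dR)
open Summit.AtomisticToContinuum.Crystallization.Theorems.OverbindingBudgetAffinePhaseCut (HNear)
open Summit.AtomisticToContinuum.Crystallization.Theorems.OverbindingBudgetAffineRunCutLetter (estab_class_fcc_of_not_hNear)
open Summit.AtomisticToContinuum.Crystallization.Theorems.OverbindingBudgetAffineCompressedCutRun (thsum_tadd tsub_tadd_self)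
open Summit.AtomisticToContinuum.Crystallization.Theorems.OverbindingBudgetAffineRunCutLevelsA (capv_mem_four exists_second_cap
  norm_mv_sq_ge_of_thsum dR_tauR_31 level_zero_site level_one_site_pos level_one_site_neg step_site)

variable {N : ℕ}

local notation "E3" => EuclideanSpace ℝ (Fin 3)

/-! ## §0 Two label identities (`thsum_tadd`, `tsub_tadd_self` are `…CompressedCutRun`'s) -/

/-- `thsum` of a difference. [this file] -/
theorem thsum_tsub (a b : T3) : thsum (tsub a b) = thsum a - thsum b := by
  unfold thsum tsub
  ring

/-- Re-centring a label: `(2ℓ,2ℓ,2ℓ) + (a − (2ℓ,2ℓ,2ℓ)) = a`. [this file] -/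
theorem tadd_tsub_centre (ℓ : ℤ) (a : T3) : tadd (2 * ℓ, 2 * ℓ, 2 * ℓ) (tsub a (2 * ℓ, 2 * ℓ, 2 * ℓ)) = a := by
  refine Prod.ext ?_ (Prod.ext ?_ ?_) <;> simp only [tadd, tsub] <;> ring

/-! ## The datum (hypotheses = the clauses of `…RunCutRebase.layer_rigidity_rebase_charts` at base `i`, frame `B`) -/

section Datum

variable {y : Fin N → E3} {i : Fin N} {A : Fin N → (E3 →ₗ[ℝ] E3)} {Qf : Fin N → (E3 →ₗᵢ[ℝ] E3)} {P : Fin N → Finset E3} {f : Fin N → E3 → E3}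
  {B : E3 →ₗ[ℝ] E3} {ref : ℤ → T3} {Cz : ℤ → List T3} {e : ℤ → ℤ}

variable (hν : 0 < nearestDist y i)
  (hP : ∀ j, dist (y j) (y i) ≤ 12 * nearestDist y i → (P j = fccTwoShellPattern ∨ P j = hcpTwoShellPattern))
  (hA : ∀ j, dist (y j) (y i) ≤ 12 * nearestDist y i → ∀ v ∈ P j, ‖A j v - Qf j v‖ ≤ 1 / 1000)
  (hf : ∀ j, dist (y j) (y i) ≤ 12 * nearestDist y i → ∀ v ∈ P j,
    f j v ∈ Set.range y ∧ dist (f j v) (y j + nearestDist y j • A j v) ≤ 1 / 10 ^ 4 * nearestDist y j)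
  (hinj : ∀ j, dist (y j) (y i) ≤ 12 * nearestDist y i → Set.InjOn (f j) ↑(P j))
  (hex : ∀ j, dist (y j) (y i) ≤ 12 * nearestDist y i → ∀ m, m ≠ j → dist (y m) (y j) ≤ (3 / 2 + 1 / 450) * nearestDist y j →
    ∃ v ∈ P j, f j v = y m)
  (hBlo : ∀ z, 399 / 400 * nearestDist y i * ‖z‖ ≤ ‖B z‖) (hBup : ∀ z, ‖B z‖ ≤ 401 / 400 * nearestDist y i * ‖z‖)
  (hC1 : ∀ ℓ : ℤ, -5 ≤ ℓ → ℓ ≤ 5 → Cz ℓ ∈ [fccL, fccNegL, hcpL, hcpAltL] ∧ thsum (ref ℓ) = 6 * ℓ ∧ (ref ℓ).2.1 = (ref ℓ).1 ∧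
      (3 : ℤ) ∣ ((ref ℓ).2.1 - (ref ℓ).2.2) ∧
      ∀ u : T3, InLayer (tsub (tadd (2 * ℓ, 2 * ℓ, 2 * ℓ) u) (ref ℓ)) → |u.1| ≤ 18 - |ℓ| → |u.2.1| ≤ 18 - |ℓ| → |u.2.2| ≤ 18 - |ℓ| →
        ∃ k : Fin N, ∃ M : E3 →ₗᵢ[ℝ] E3,
          dist (y k) (y i) ≤ 12 * nearestDist y i ∧ 9026 / 10000 * nearestDist y i ≤ nearestDist y k ∧
          nearestDist y k ≤ 10347 / 10000 * nearestDist y i ∧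
          Estab y A P B i k M (Cz ℓ) (tadd (2 * ℓ, 2 * ℓ, 2 * ℓ) u) (tauR (nearestDist y i) 31) (dR (nearestDist y i) 31))
  (hC2 : ∀ ℓ : ℤ, -5 ≤ ℓ → ℓ ≤ 4 → (e ℓ = 1 ∨ e ℓ = -1) ∧ ref (ℓ + 1) = tadd (ref ℓ) (capv 1 (e ℓ) (1, 1, -2)) ∧
      (∀ δ ∈ dL, capv 1 (e ℓ) δ ∈ Cz ℓ) ∧ (∀ δ ∈ dL, capv (-1) (-(e ℓ)) δ ∈ Cz (ℓ + 1)))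
  (hC3 : ∃ x₀ : T3, InLayer x₀ ∧ tadd (ref 0) x₀ = (0, 0, 0))
  (hC4 : ∀ m, dist (y m) (y i) ≤ 106 / 25 * nearestDist y i → ∃ (ℓ : ℤ) (x : T3), -5 ≤ ℓ ∧ ℓ ≤ 5 ∧ InLayer x ∧
      ‖y m - y i - B (mv (tadd (ref ℓ) x))‖ ≤
        dR (nearestDist y i) 31 + 1 / 10 ^ 4 * (10347 / 10000 * nearestDist y i) + tauR (nearestDist y i) 31 ∧
      9967 / 10000 * (9026 / 10000 * nearestDist y i) ≤ nearestDist y m)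
  (hC5 : ∀ (m m' : Fin N) (r : T3), 9967 / 10000 * (9026 / 10000 * nearestDist y i) ≤ nearestDist y m' →
      ‖y m - y i - B (mv r)‖ ≤ dR (nearestDist y i) 31 + 1 / 10 ^ 4 * (10347 / 10000 * nearestDist y i) + tauR (nearestDist y i) 31 →
      ‖y m' - y i - B (mv r)‖ ≤ dR (nearestDist y i) 31 + 1 / 10 ^ 4 * (10347 / 10000 * nearestDist y i) + tauR (nearestDist y i) 31 →
      m = m')

/-! ## §1 (β) Level identification -/

section Ident

include hν hBlo hC1 hC4 hC5

/-- ★★ **(β) LEVEL IDENTIFICATION.**  A site `m` within `2ν` of the base that sits within the clause tolerance of `B (mv a)` for an integer label `a`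
of coordinate sum `6ℓ₀`, `|ℓ₀| ≤ 2`, is established at level `ℓ₀` with class `Cz ℓ₀` (and has the record scale window).  The layer spacing
`√(2/3)·(399/400)ν = 0.8145ν` beats twice the tolerance `2·0.3902ν`; nothing finer than the level is identified. [this file] -/
theorem estab_of_near_label {m : Fin N} {a : T3} {ℓ₀ : ℤ} (h1 : -2 ≤ ℓ₀) (h2 : ℓ₀ ≤ 2)
    (hdm : dist (y m) (y i) ≤ 2 * nearestDist y i) (hsum : thsum a = 6 * ℓ₀)
    (hpos : ‖y m - y i - B (mv a)‖ ≤ dR (nearestDist y i) 31 + 1 / 10 ^ 4 * (10347 / 10000 * nearestDist y i) + tauR (nearestDist y i) 31) :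
    ∃ (M : E3 →ₗᵢ[ℝ] E3) (lam : T3), 9026 / 10000 * nearestDist y i ≤ nearestDist y m ∧ nearestDist y m ≤ 10347 / 10000 * nearestDist y i ∧
      Estab y A P B i m M (Cz ℓ₀) lam (tauR (nearestDist y i) 31) (dR (nearestDist y i) 31) := by
  obtain ⟨hD, hτ⟩ := dR_tauR_31 (nearestDist y i)
  obtain ⟨ℓ', x, hℓ'1, hℓ'2, hxL, hpos', hνm⟩ := hC4 m (hdm.trans (by nlinarith [hν]))
  -- (1) the two labels carry the same level
  have hdiff : ‖B (mv (tsub (tadd (ref ℓ') x) a))‖ ≤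
      2 * (dR (nearestDist y i) 31 + 1 / 10 ^ 4 * (10347 / 10000 * nearestDist y i) + tauR (nearestDist y i) 31) := by
    have h := norm_sub_le (y m - y i - B (mv a)) (y m - y i - B (mv (tadd (ref ℓ') x)))
    have e1 : (y m - y i - B (mv a)) - (y m - y i - B (mv (tadd (ref ℓ') x))) = B (mv (tsub (tadd (ref ℓ') x) a)) := by
      rw [mv_tsub, B.map_sub]; abel
    rw [e1] at h
    linarith
  have hx0 : thsum x = 0 := hxL.1
  have hlev : ℓ' = ℓ₀ := by
    by_contra hne
    have hth : thsum (tsub (tadd (ref ℓ') x) a) = 6 * (ℓ' - ℓ₀) := by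
      rw [thsum_tsub, thsum_tadd, (hC1 ℓ' hℓ'1 hℓ'2).2.1, hx0, hsum]; ring
    have hge := norm_mv_sq_ge_of_thsum hth (sub_ne_zero.mpr hne)
    have hl := hBlo (mv (tsub (tadd (ref ℓ') x) a))
    rw [hD, hτ] at hdiff
    have hm : ‖mv (tsub (tadd (ref ℓ') x) a)‖ ≤ 79 / 100 := by
      by_contra hc
      rw [not_le] at hc
      nlinarith [mul_le_mul_of_nonneg_left hc.le hν.le]
    nlinarith [norm_nonneg (mv (tsub (tadd (ref ℓ') x) a))]
  subst hlev
  -- (2) the layer label is in the box of the establishment clause: `tsq ≤ 103`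
  have hBa : ‖B (mv (tadd (ref ℓ') x))‖ ≤ 2 * nearestDist y i +
      (dR (nearestDist y i) 31 + 1 / 10 ^ 4 * (10347 / 10000 * nearestDist y i) + tauR (nearestDist y i) 31) := by
    have h := norm_sub_le (y m - y i) (y m - y i - B (mv (tadd (ref ℓ') x)))
    have e2 : (y m - y i) - (y m - y i - B (mv (tadd (ref ℓ') x))) = B (mv (tadd (ref ℓ') x)) := by abel
    rw [e2, ← dist_eq_norm] at h
    linarith
  have hma : ‖mv (tadd (ref ℓ') x)‖ ≤ 12 / 5 := by
    have hl := hBlo (mv (tadd (ref ℓ') x))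
    rw [hD, hτ] at hBa
    by_contra hc
    rw [not_le] at hc
    nlinarith [mul_le_mul_of_nonneg_left hc.le hν.le]
  have htsq : tsq (tadd (ref ℓ') x) ≤ 103 := by
    have h := norm_mv_sq (tadd (ref ℓ') x)
    have h' : (tsq (tadd (ref ℓ') x) : ℝ) < 104 := by nlinarith [norm_nonneg (mv (tadd (ref ℓ') x))]
    have h'' : tsq (tadd (ref ℓ') x) < 104 := by exact_mod_cast h'
    omega
  have hcomp : ∀ c : ℤ, c * c ≤ 103 → -10 ≤ c ∧ c ≤ 10 := fun c hc => by constructor <;> nlinarith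
  have hb1 : -10 ≤ (tadd (ref ℓ') x).1 ∧ (tadd (ref ℓ') x).1 ≤ 10 := by
    refine hcomp _ ?_
    unfold tsq at htsq
    nlinarith [mul_self_nonneg (tadd (ref ℓ') x).2.1, mul_self_nonneg (tadd (ref ℓ') x).2.2]
  have hb2 : -10 ≤ (tadd (ref ℓ') x).2.1 ∧ (tadd (ref ℓ') x).2.1 ≤ 10 := by
    refine hcomp _ ?_
    unfold tsq at htsq
    nlinarith [mul_self_nonneg (tadd (ref ℓ') x).1, mul_self_nonneg (tadd (ref ℓ') x).2.2]
  have hb3 : -10 ≤ (tadd (ref ℓ') x).2.2 ∧ (tadd (ref ℓ') x).2.2 ≤ 10 := by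
    refine hcomp _ ?_
    unfold tsq at htsq
    nlinarith [mul_self_nonneg (tadd (ref ℓ') x).1, mul_self_nonneg (tadd (ref ℓ') x).2.1]
  have habs : |ℓ'| ≤ 2 := abs_le.mpr ⟨h1, h2⟩
  -- (3) establishment at level `ℓ'` and site uniqueness
  obtain ⟨-, -, -, -, hsite⟩ := hC1 ℓ' hℓ'1 hℓ'2
  have hcen := tadd_tsub_centre ℓ' (tadd (ref ℓ') x)
  obtain ⟨k, M, -, hνlo, hνhi, hE⟩ := hsite (tsub (tadd (ref ℓ') x) (2 * ℓ', 2 * ℓ', 2 * ℓ'))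
    (by rw [hcen, tsub_tadd_self]; exact hxL)
    (by simp only [tsub]; exact abs_le.mpr ⟨by linarith [hb1.1, abs_nonneg ℓ', le_abs_self ℓ', neg_abs_le ℓ'],
      by linarith [hb1.2, abs_nonneg ℓ', le_abs_self ℓ', neg_abs_le ℓ']⟩)
    (by simp only [tsub]; exact abs_le.mpr ⟨by linarith [hb2.1, abs_nonneg ℓ', le_abs_self ℓ', neg_abs_le ℓ'],
      by linarith [hb2.2, abs_nonneg ℓ', le_abs_self ℓ', neg_abs_le ℓ']⟩)
    (by simp only [tsub]; exact abs_le.mpr ⟨by linarith [hb3.1, abs_nonneg ℓ', le_abs_self ℓ', neg_abs_le ℓ'],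
      by linarith [hb3.2, abs_nonneg ℓ', le_abs_self ℓ', neg_abs_le ℓ']⟩)
  rw [hcen] at hE
  have hDT : dR (nearestDist y i) 31 ≤
      dR (nearestDist y i) 31 + 1 / 10 ^ 4 * (10347 / 10000 * nearestDist y i) + tauR (nearestDist y i) 31 := by
    rw [hD, hτ]; nlinarith [hν]
  have hkm : k = m := hC5 k m (tadd (ref ℓ') x) hνm (hE.2.2.trans hDT) hpos'
  subst hkm
  exact ⟨M, tadd (ref ℓ') x, hνlo, hνhi, hE⟩

end Ident

/-! ## §2 Levels `±2` and the assembly -/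

section Assembly

include hν hP hA hf hex hBlo hBup hC1 hC2 hC3 hC4 hC5

/-- **LEVEL +2**: an established site of class `Cz 2` within `2ν` (cap of the level-`+1` cap site). [this file] -/
theorem level_two_site_pos : ∃ (m : Fin N) (M : E3 →ₗᵢ[ℝ] E3) (lam : T3), dist (y m) (y i) ≤ 2 * nearestDist y i ∧
    Estab y A P B i m M (Cz 2) lam (tauR (nearestDist y i) 31) (dR (nearestDist y i) 31) := by
  obtain ⟨k, M, -, hlo, hhi, hE⟩ := level_one_site_pos hν hBup hC1 hC2 hC3
  obtain ⟨he0, -, -, -⟩ := hC2 0 (by norm_num) (by norm_num)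
  obtain ⟨he1, -, hcap1, -⟩ := hC2 1 (by norm_num) (by norm_num)
  obtain ⟨δ, hδ, h54, hx18⟩ := exists_second_cap (σ := 1) (Or.inl rfl) he0 he1
  obtain ⟨hr4, hr18⟩ := capv_mem_four (σ := 1) (Or.inl rfl) he0
  obtain ⟨k', hdk', hpos'⟩ :=
    step_site hν hP hA hf hex hBlo hBup hE (hC1 1 (by norm_num) (by norm_num)).1 hr4 hr18 hlo hhi (hcap1 δ hδ) hx18 h54
  have hsum : thsum (tadd (capv 1 (e 0) (1, 1, -2)) (capv 1 (e 1) δ)) = 6 * 2 := by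
    rw [thsum_tadd, thsum_capv (by decide), thsum_capv hδ]; ring
  obtain ⟨M', lam, -, -, hE'⟩ := estab_of_near_label hν hBlo hC1 hC4 hC5 (by norm_num) (by norm_num) hdk' hsum hpos'
  exact ⟨k', M', lam, hdk', hE'⟩

/-- **LEVEL −2**: an established site of class `Cz (−2)` within `2ν`. [this file] -/
theorem level_two_site_neg : ∃ (m : Fin N) (M : E3 →ₗᵢ[ℝ] E3) (lam : T3), dist (y m) (y i) ≤ 2 * nearestDist y i ∧
    Estab y A P B i m M (Cz (-2)) lam (tauR (nearestDist y i) 31) (dR (nearestDist y i) 31) := by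
  obtain ⟨k, M, -, hlo, hhi, hE⟩ := level_one_site_neg hν hBup hC1 hC2 hC3
  obtain ⟨he1, -, -, -⟩ := hC2 (-1) (by norm_num) (by norm_num)
  obtain ⟨he2, -, -, hcap2⟩ := hC2 (-2) (by norm_num) (by norm_num)
  rw [show (-2 : ℤ) + 1 = -1 from by norm_num] at hcap2
  have he1' : -(e (-1)) = 1 ∨ -(e (-1)) = -1 := by rcases he1 with h | h <;> simp [h]
  have he2' : -(e (-2)) = 1 ∨ -(e (-2)) = -1 := by rcases he2 with h | h <;> simp [h]
  obtain ⟨δ, hδ, h54, hx18⟩ := exists_second_cap (σ := -1) (Or.inr rfl) he1' he2'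
  obtain ⟨hr4, hr18⟩ := capv_mem_four (σ := -1) (Or.inr rfl) he1'
  obtain ⟨k', hdk', hpos'⟩ :=
    step_site hν hP hA hf hex hBlo hBup hE (hC1 (-1) (by norm_num) (by norm_num)).1 hr4 hr18 hlo hhi (hcap2 δ hδ) hx18 h54
  have hsum : thsum (tadd (capv (-1) (-(e (-1))) (1, 1, -2)) (capv (-1) (-(e (-2))) δ)) = 6 * (-2) := by
    rw [thsum_tadd, thsum_capv (by decide), thsum_capv hδ]; ring
  obtain ⟨M', lam, -, -, hE'⟩ := estab_of_near_label hν hBlo hC1 hC4 hC5 (by norm_num) (by norm_num) hdk' hsum hpos'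
  exact ⟨k', M', lam, hdk', hE'⟩

/-- ★★ **EVERY LEVEL `|ℓ| ≤ 2` CARRIES AN ESTABLISHED SITE WITHIN `2ν`** of the base. [this file] -/
theorem level_site : ∀ ℓ : ℤ, -2 ≤ ℓ → ℓ ≤ 2 → ∃ (m : Fin N) (M : E3 →ₗᵢ[ℝ] E3) (lam : T3), dist (y m) (y i) ≤ 2 * nearestDist y i ∧
    Estab y A P B i m M (Cz ℓ) lam (tauR (nearestDist y i) 31) (dR (nearestDist y i) 31) := by
  intro ℓ h1 h2
  have h1369 : ∀ {m : Fin N}, dist (y m) (y i) ≤ 1369 / 1000 * nearestDist y i → dist (y m) (y i) ≤ 2 * nearestDist y i :=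
    fun h => h.trans (by nlinarith [hν])
  interval_cases ℓ
  · exact level_two_site_neg hν hP hA hf hex hBlo hBup hC1 hC2 hC3 hC4 hC5
  · obtain ⟨k, M, hd, -, -, hE⟩ := level_one_site_neg hν hBup hC1 hC2 hC3
    exact ⟨k, M, _, h1369 hd, hE⟩
  · obtain ⟨k, M, hd, -, -, hE⟩ := level_zero_site hν hBup hC1 hC3
    exact ⟨k, M, _, h1369 hd, hE⟩
  · obtain ⟨k, M, hd, -, -, hE⟩ := level_one_site_pos hν hBup hC1 hC2 hC3
    exact ⟨k, M, _, h1369 hd, hE⟩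
  · exact level_two_site_pos hν hP hA hf hex hBlo hBup hC1 hC2 hC3 hC4 hC5

include hinj

/-- ★★★ **(T2-metric)+(β): FIVE CUBIC LEVELS FROM THE PIVOT'S OWN DATUM.**  If no site within `2ν` of the base `i` is `HFramed (3/50) (1/450)`
(`¬HNear 2 …`, the exclusion carried by the leaf `StackSwapGainFlatWide`), then every class `Cz ℓ`, `|ℓ| ≤ 2`, of the re-based layer-rigidity datum
at `i` is cubic. [this file] -/
theorem levels_fcc_of_not_hNear (hn : ¬ HNear 2 (3 / 50) (1 / 450) y i) :
    ∀ ℓ : ℤ, -2 ≤ ℓ → ℓ ≤ 2 → Cz ℓ = fccL ∨ Cz ℓ = fccNegL := by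
  intro ℓ h1 h2
  obtain ⟨m, M, lam, hdm, hE⟩ := level_site hν hP hA hf hex hBlo hBup hC1 hC2 hC3 hC4 hC5 ℓ h1 h2
  have hm12 : dist (y m) (y i) ≤ 12 * nearestDist y i := hdm.trans (by nlinarith [hν])
  exact estab_class_fcc_of_not_hNear (hP m hm12) (hA m hm12) (hf m hm12) (hinj m hm12) (hex m hm12) hn hdm hE
    (hC1 ℓ (by omega) (by omega)).1

end Assembly

end Datum

end Summit.AtomisticToContinuum.Crystallization.Theorems.OverbindingBudgetAffineRunCutLevels
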